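/-
Copyright (c) 2026 the pub-hodgecm-mathlib formalisation cell (harness21).  Prover seat hodgecm-mathlib-K2Liu-p09 (g7): Track B «K2-LIT»,
hLiu418 = stmt-HodgeConjecture-24832; LEAD F0P6-plan RULINGS M-158d «A7-val road (σ)» and σ19∕σ21 — `hne` organ, brick (N3): the witness binder `hne` of the face
(A4″-KR) from SPANNING by two theta images exchanged by a similitude.
-/
import Summits.HodgeConjecture.HodgeConjecture.Theorems.K2LiuA7ValueWitnessTransport   -- ★ (N2) p861462 (`exists_witness_mem_of_add`; brings ★ glue, ★ (N0), ★ V8a, ★ V1d)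
import Summits.HodgeConjecture.HodgeConjecture.Theorems.K2LiuBigCellPieceWitness      -- ★ (N3a) p861527 (`exists_bigCell_piece`)
import Summits.HodgeConjecture.HodgeConjecture.Theorems.K2LiuA7ValueWitnessGlue       -- ★ V8g p860874 (brings ★ V7b `value_bigCell_two_ne_zero`, ★ B8-CM `exists_adaptedFrame`, ★ B7, ★ `volume_inter_ne_zero`)
import Summits.HodgeConjecture.HodgeConjecture.Theorems.K2LiuSiegelIntertwiningIntegrable  -- ★ V1c p859737 (`integrable_weylDelta_mul`)
import HarnessLib

/-!
# Crux `HLiu418`, road `K2_Liu`, organ A7-val, `hne` organ brick (N3): THE WITNESS BINDER `hne` FROM SPANNING BY TWO THETA IMAGES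

Cell `hodgecm-mathlib`, crux item hLiu418 = `stmt-HodgeConjecture-24832`; squad K2 ∕ K2Liu; prover K2Liu-p09 (g7), organ lead A7-val.  THEOREMS ONLY; lane
`--supports stmt-HodgeConjecture-24832` (count-neutral helper).  Generic D10 currency at `n = 2` (★ V7b is rank-two), every finite place with `χ_F(ϖ_v) ≠ 1` (`hu`; every
non-split `v`), model-generic section map `𝒜 : V →ₗ I_v(½, χ_v)` — the currency of ★ V8e `face_two_of_laws` ∕ ★ V8g.  HYPOTHESIS-FIRST in: the second theta image `R₁`, a
`P_Δ`-preserving automorphism `θ` with its four laws (★ (N2); at the instance `Ad d_{c₁}`, K2Liu-p10 (g5) T1∕T2), SPANNING `I_v(½) = 𝒜(V) + R₁` (★ S1 organ) and TRANSPORT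
`R₁ ∘ θ ≤ 𝒜(V)` (★ `exists_mover_localSWImage_map_localCongr_dA`), and ONE smooth Siegel section `φ⁰` with `φ⁰(w_Δ) ≠ 0`.
* **`hne_of_spanning`** — V8e's binder `hne` VERBATIM (for EVERY Iwasawa compact open `K₀`: `Φ₀ ∈ V`, the `K₀`-flat family `f` through `𝒜 Φ₀`, its datum `Fn` with `Fn(½)(1) ≠ 0`).
  Assembly: ★ (N3a) big-cell piece of `φ⁰` (compact profile, period `≠ 0`) → ★ V1d flat family + ★ B7 datum (frame ★ `exists_adaptedFrame`) + ★ V7b (`Fn(½)(1) = Λ·a(½)⁻¹ ≠ 0`,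
  `hu`) → spanning splits the piece as `𝒜 Φa + φ₁` → ★ (N2) `exists_witness_mem_of_add` (glue + transport + level-freeness) gives the witness THROUGH AN ELEMENT OF `𝒜(V)`.
HONEST LABEL.  `HC_CM` is proved only modulo the 7 printed citations (2 remaining named inputs: hLiu418 = `stmt-HodgeConjecture-24832`,
h413 = `stmt-HodgeConjecture-24833`) until rung 0 closes.

## References
* [KudlaSweet1997] S. Kudla, W. J. Sweet, Israel J. Math. 98 (1997), §1, Thm. 1.2 (`I_n(s₀, χ) = R_n(V⁺) + R_n(V⁻)`).
* [Kudla1994] S. Kudla, Israel J. Math. 87 (1994), §3 (similitudes of the doubled space; the big cell).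
* [HarrisKudlaSweet1996] M. Harris, S. Kudla, W. J. Sweet, J. AMS 9 (1996), §6 (6.16).
* [Casselman1980] W. Casselman, Compositio Math. 40 (1980), §3.
-/

set_option autoImplicit false
set_option linter.dupNamespace false -- the mandated namespace repeats `HodgeConjecture.HodgeConjecture`

noncomputable section

open scoped Classical NNReal ENNReal
open NumberField IsDedekindDomain MeasureTheory Topology
open Literature.NumberTheory.GaloisRepresentations Literature.NumberTheory.GaloisRepresentations.IsNonarchimedeanLocalField
open Literature.NumberTheory.Automorphic Literature.NumberTheory.Automorphic.UnitaryGroup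
open Literature.NumberTheory.GelbartRogawski1991.UnitaryDualPair.LocalSplitting
open Literature.NumberTheory.K2Lit.LocalSiegelDoubled
open Summit.HodgeConjecture.HodgeConjecture.Cruxes.HLiu418.K2LiuQRationalDefs
open Summit.HodgeConjecture.HodgeConjecture.Cruxes.HLiu418.K2LiuLocalLFactorDefs
open Summit.HodgeConjecture.HodgeConjecture.Cruxes.HLiu418.K2LiuLocalSiegel
open Summit.HodgeConjecture.HodgeConjecture.Cruxes.HLiu418.K2LiuFlatSiegelFamilies
open Summit.HodgeConjecture.HodgeConjecture.Cruxes.HLiu418.K2LiuA7ValueFunctional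
open Summit.HodgeConjecture.HodgeConjecture.Cruxes.HLiu418.K2LiuA7ValueSiegelLaw
open Summit.HodgeConjecture.HodgeConjecture.Cruxes.HLiu418.K2LiuA7ValueBigCellTwo
open Summit.HodgeConjecture.HodgeConjecture.Cruxes.HLiu418.K2LiuA7NormalisedRegularity
open Summit.HodgeConjecture.HodgeConjecture.Cruxes.HLiu418.K2LiuA7NormalisedRegularityCM
open Summit.HodgeConjecture.HodgeConjecture.Cruxes.HLiu418.K2LiuA7NormalisedRegularitySetup
open Summit.HodgeConjecture.HodgeConjecture.Cruxes.HLiu418.K2LiuSiegelIntertwiningIntegrable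
open Summit.HodgeConjecture.HodgeConjecture.Cruxes.HLiu418.K2LiuA7ValueWitnessTransport
open Summit.HodgeConjecture.HodgeConjecture.Cruxes.HLiu418.K2LiuBigCellPieceWitness

namespace Summit.HodgeConjecture.HodgeConjecture.Cruxes.HLiu418.K2LiuA7ValueWitnessOfSpanning

variable (F : Type) [Field F] [NumberField F] (E : Type) [Field E] [NumberField E] [Algebra F E]
  [Algebra.IsQuadraticExtension F E] (c : E ≃ₐ[F] E)
  {δ : E} (hcδ : c δ = -δ) (hδ : δ ≠ 0) {d : F} (hd : δ * δ = algebraMap F E d) (v : HeightOneSpectrum (𝓞 F))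
  {T₀ : Matrix (Fin 2) (Fin 2) F} (hT₀ : T₀.IsSymm) (hT₀d : IsUnit T₀.det)
  {JD : Matrix (Fin (2 + 2)) (Fin (2 + 2)) E} (hJD : JD = (gramD F 2 T₀).map (algebraMap F E))
  {χv : ∀ w : PlacesOver E v, (w.1.adicCompletion E)ˣ →* ℂˣ} (hχ : ∀ (w : PlacesOver E v) (x : (w.1.adicCompletion E)ˣ), ‖((χv w x : ℂˣ) : ℂ)‖ = 1)
  [MeasurableSpace (unipDeltaLocal F E c v 2 (JD := JD))] [BorelSpace (unipDeltaLocal F E c v 2 (JD := JD))]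
  (νN : Measure (unipDeltaLocal F E c v 2 (JD := JD))) [νN.IsHaarMeasure]
  {V : Type*} [AddCommGroup V] [Module ℂ V] (𝒜 : V →ₗ[ℂ] ↥(localDegPS F E c hcδ hδ hd v 2 hT₀ hJD χv (1 / 2)))
  -- the similitude `θ` with its four laws (★ (N2) currency)
  (θ : UnitaryGroup.localPi E c (2 + 2) JD v ≃ₜ* UnitaryGroup.localPi E c (2 + 2) JD v)
  (hθP : ∀ p : UnitaryGroup.localPi E c (2 + 2) JD v, IsSiegelDelta F E c hcδ hδ hd v 2 hT₀ hJD p ↔ IsSiegelDelta F E c hcδ hδ hd v 2 hT₀ hJD (θ p))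
  (hθS : ∀ (s : ℂ) (g : UnitaryGroup.localPi E c (2 + 2) JD v → ℂ), IsLocalSiegelSection F E c hcδ hδ hd v 2 hT₀ hJD χv s g →
    IsLocalSiegelSection F E c hcδ hδ hd v 2 hT₀ hJD χv s (g ∘ θ))
  (hθsm : ∀ g : UnitaryGroup.localPi E c (2 + 2) JD v → ℂ, IsSmooth F E c v 2 g → IsSmooth F E c v 2 (g ∘ θ))
  (cθ : ℂ → ℂ) (hcθ : IsQRationalRegularAt (residueFieldCard (v.adicCompletion F)) (1 / 2) cθ) (hcθ0 : cθ (1 / 2) ≠ 0)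
  (hθM : ∀ (g : UnitaryGroup.localPi E c (2 + 2) JD v → ℂ) (s : ℂ), IsLocalSiegelSection F E c hcδ hδ hd v 2 hT₀ hJD χv s g → IsSmooth F E c v 2 g → 1 < s.re →
    ∀ h, localIntertwining F E c v 2 hJD νN (g ∘ θ) h = cθ s * localIntertwining F E c v 2 hJD νN g (θ h))
  -- the second theta image, spanning, transport
  (R₁ : Submodule ℂ (UnitaryGroup.localPi E c (2 + 2) JD v → ℂ)) (hR₁ : R₁ ≤ localDegPS F E c hcδ hδ hd v 2 hT₀ hJD χv (1 / 2))
  (hspan : ∀ φ ∈ localDegPS F E c hcδ hδ hd v 2 hT₀ hJD χv (1 / 2), ∃ (Φ : V) (φ₁ : UnitaryGroup.localPi E c (2 + 2) JD v → ℂ), φ₁ ∈ R₁ ∧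
    φ = ((𝒜 Φ : ↥(localDegPS F E c hcδ hδ hd v 2 hT₀ hJD χv (1 / 2))) : UnitaryGroup.localPi E c (2 + 2) JD v → ℂ) + φ₁)
  (hR₁θ : ∀ φ₁ ∈ R₁, ∃ Φ : V, ((𝒜 Φ : ↥(localDegPS F E c hcδ hδ hd v 2 hT₀ hJD χv (1 / 2))) : UnitaryGroup.localPi E c (2 + 2) JD v → ℂ) = φ₁ ∘ θ)
  -- one smooth Siegel section with `φ⁰(w_Δ) ≠ 0`, and the place condition `χ_F(ϖ_v) ≠ 1`
  (φ₀ : UnitaryGroup.localPi E c (2 + 2) JD v → ℂ) (hφ₀ : φ₀ ∈ localDegPS F E c hcδ hδ hd v 2 hT₀ hJD χv (1 / 2)) (hφ₀w : φ₀ (weylDelta F E c v 2 hJD) ≠ 0)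
  (hu : unramValue F v (chiF F E v χv) ≠ 1)

include hT₀d hχ hθP hθS hθsm hcθ hcθ0 hθM hR₁ hspan hR₁θ hφ₀ hφ₀w hu in
/-- **`hne` FROM SPANNING**: V8e's witness binder `hne` of ★ `face_two_of_laws` for the section map `𝒜` — for EVERY Iwasawa compact open `K₀ ≤ H_v` a vector `Φ₀ ∈ V`, the
`K₀`-flat family `f` through `𝒜 Φ₀` and its (A4′-R) datum `Fn` with `Fn(½)(1) ≠ 0` — from spanning `I_v(½) = 𝒜(V) + R₁`, the transport `R₁ ∘ θ ≤ 𝒜(V)` along a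
`P_Δ`-preserving `θ` with the intertwining law, and one smooth Siegel section non-zero at `w_Δ`. [cite: KudlaSweet1997, §1, Thm. 1.2] [cite: Kudla1994, §3]
[cite: HarrisKudlaSweet1996, §6 (6.16)] [cite: Casselman1980, §3] -/
theorem hne_of_spanning
    (K₀ : Subgroup (UnitaryGroup.localPi E c (2 + 2) JD v))
    (hK₀ : IsCompact (K₀ : Set (UnitaryGroup.localPi E c (2 + 2) JD v)) ∧ IsOpen (K₀ : Set (UnitaryGroup.localPi E c (2 + 2) JD v)))
    (hIw : ∀ x : UnitaryGroup.localPi E c (2 + 2) JD v, ∃ p, IsSiegelDelta F E c hcδ hδ hd v 2 hT₀ hJD p ∧ ∃ k ∈ K₀, x = p * k) :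
    ∃ (Φ₁ : V) (f Fn : ℂ → UnitaryGroup.localPi E c (2 + 2) JD v → ℂ),
      (∀ s, IsLocalSiegelSection F E c hcδ hδ hd v 2 hT₀ hJD χv s (f s)) ∧ (∀ s, IsSmooth F E c v 2 (f s)) ∧ (∀ s s' : ℂ, ∀ k ∈ K₀, f s k = f s' k) ∧
      f (1 / 2) = ((𝒜 Φ₁ : ↥(localDegPS F E c hcδ hδ hd v 2 hT₀ hJD χv (1 / 2))) : UnitaryGroup.localPi E c (2 + 2) JD v → ℂ) ∧
      (∀ h, IsQRationalRegularAt (residueFieldCard (v.adicCompletion F)) (1 / 2) fun s => Fn s h) ∧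
      (∀ s : ℂ, 1 < s.re → ∀ h, localIntertwining F E c v 2 hJD νN (f s) h =
        aNorm F E c v 2 χv (νN.real {u | (u : UnitaryGroup.localPi E c (2 + 2) JD v) ∈ K₀}) s * Fn s h) ∧ Fn (1 / 2) 1 ≠ 0 := by
  -- the normaliser and the (A4′-R) ∕ integrability faces for `K₀`
  have hvol := volume_inter_ne_zero F E c v 2 νN K₀ hK₀
  have haN : ∀ s : ℂ, 1 < s.re → aNorm F E c v 2 χv (νN.real {u | (u : UnitaryGroup.localPi E c (2 + 2) JD v) ∈ K₀}) s ≠ 0 := fun s hs =>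
    aNorm_two_ne_zero F E c v hχ hvol hs
  obtain ⟨D, Dinv, Q, hDD, hDD', hQm, hQ⟩ := exists_adaptedFrame F 2 hT₀ hT₀d
  have hA4R : ∀ f' : ℂ → UnitaryGroup.localPi E c (2 + 2) JD v → ℂ, (∀ s, IsLocalSiegelSection F E c hcδ hδ hd v 2 hT₀ hJD χv s (f' s)) →
      (∀ s, IsSmooth F E c v 2 (f' s)) → (∀ s s' : ℂ, ∀ k ∈ K₀, f' s k = f' s' k) →
      ∃ Fn' : ℂ → UnitaryGroup.localPi E c (2 + 2) JD v → ℂ, (∀ h, IsQRationalRegularAt (residueFieldCard (v.adicCompletion F)) (1 / 2) fun s => Fn' s h) ∧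
        ∀ s : ℂ, 1 < s.re → ∀ h, localIntertwining F E c v 2 hJD νN (f' s) h =
          aNorm F E c v 2 χv (νN.real {u | (u : UnitaryGroup.localPi E c (2 + 2) JD v) ∈ K₀}) s * Fn' s h := fun f' hS' hsm' hfl' =>
    normalisedRegularity F E c hcδ hδ hd v hT₀ hJD D Dinv hDD hDD' Q hQm hQ νN χv hχ K₀ hK₀ hIw f' hS' hsm' hfl'
  have hintA : ∀ f' : ℂ → UnitaryGroup.localPi E c (2 + 2) JD v → ℂ, (∀ s, IsLocalSiegelSection F E c hcδ hδ hd v 2 hT₀ hJD χv s (f' s)) →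
      (∀ s, IsSmooth F E c v 2 (f' s)) → (∀ s s' : ℂ, ∀ k ∈ K₀, f' s k = f' s' k) → ∀ s : ℂ, 1 < s.re → ∀ h,
        Integrable (fun u : unipDeltaLocal F E c v 2 (JD := JD) => f' s (weylDelta F E c v 2 hJD * (u : UnitaryGroup.localPi E c (2 + 2) JD v) * h)) νN :=
    fun f' hS' hsm' _ s hs h => integrable_weylDelta_mul F E c hcδ hδ hd v hT₀ hJD hT₀d νN hχ hs (hS' s) (hsm' s) h
  -- the big-cell piece of `φ⁰` and its `K₀`-witness (★ (N3a), ★ V1d, ★ B7, ★ V7b)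
  have hφ₀' := hφ₀
  rw [mem_localDegPS_iff] at hφ₀'
  obtain ⟨fbc, hSbc, hsmbc, ⟨C, hC, hsupp⟩, hΛ⟩ :=
    exists_bigCell_piece F E c hcδ hδ hd v 2 hT₀ hT₀d hJD χv (1 / 2) νN K₀ hK₀ φ₀ hφ₀'.1 hφ₀'.2 hφ₀w
  obtain ⟨f, hS, hsm, hfl, hthr⟩ := exists_flatFamily F E c hcδ hδ hd v 2 hT₀ hJD χv K₀ hK₀ hIw (1 / 2) hSbc hsmbc
  obtain ⟨Fn, hreg, hfac⟩ := hA4R f hS hsm hfl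
  have hsupp' : ∀ u : unipDeltaLocal F E c v 2 (JD := JD), u ∉ C →
      f (1 / 2) (weylDelta F E c v 2 hJD * (u : UnitaryGroup.localPi E c (2 + 2) JD v)) = 0 := fun u hu' => by rw [hthr]; exact hsupp u hu'
  have hΛ' : (∫ u, f (1 / 2) (weylDelta F E c v 2 hJD * (u : UnitaryGroup.localPi E c (2 + 2) JD v)) ∂νN) ≠ 0 := by rw [hthr]; exact hΛ
  have hne := value_bigCell_two_ne_zero F E c hcδ hδ hd v hT₀ hJD hχ hvol K₀ hK₀ hIw νN hS hfl (hsm (1 / 2)) C hC hsupp' (hreg 1)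
    (fun s hs => hfac s hs 1) hΛ' hu
  -- spanning splits the piece; the first theta image as a submodule of functions
  have hfbc : fbc ∈ localDegPS F E c hcδ hδ hd v 2 hT₀ hJD χv (1 / 2) := by
    rw [mem_localDegPS_iff]; exact ⟨hSbc, hsmbc⟩
  obtain ⟨Φa, φ₁, hφ₁, hdec⟩ := hspan fbc hfbc
  have hR₀ : (LinearMap.range 𝒜).map (localDegPS F E c hcδ hδ hd v 2 hT₀ hJD χv (1 / 2)).subtype ≤ localDegPS F E c hcδ hδ hd v 2 hT₀ hJD χv (1 / 2) :=
    Submodule.map_subtype_le _ _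
  have hmemR₀ : ∀ Φ : V, ((𝒜 Φ : ↥(localDegPS F E c hcδ hδ hd v 2 hT₀ hJD χv (1 / 2))) : UnitaryGroup.localPi E c (2 + 2) JD v → ℂ) ∈
      (LinearMap.range 𝒜).map (localDegPS F E c hcδ hδ hd v 2 hT₀ hJD χv (1 / 2)).subtype := fun Φ =>
    Submodule.mem_map.2 ⟨𝒜 Φ, LinearMap.mem_range_self 𝒜 Φ, rfl⟩
  have hφ₁θ : φ₁ ∘ θ ∈ (LinearMap.range 𝒜).map (localDegPS F E c hcδ hδ hd v 2 hT₀ hJD χv (1 / 2)).subtype := by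
    obtain ⟨Φ, hΦ⟩ := hR₁θ φ₁ hφ₁
    rw [← hΦ]; exact hmemR₀ Φ
  -- ★ (N2): one theta image suffices
  obtain ⟨ψ, hψ, f', Fn', hS', hsm', hfl', hthr', hreg', hfac', hne'⟩ :=
    exists_witness_mem_of_add F E c hcδ hδ hd v 2 hT₀ hJD χv νN (νN.real {u | (u : UnitaryGroup.localPi E c (2 + 2) JD v) ∈ K₀}) haN K₀ hK₀ hIw hA4R hintA
      θ hθP hθS hθsm cθ hcθ hcθ0 hθM _ hR₀ _ φ₁ (hmemR₀ Φa) (hR₁ hφ₁) hφ₁θ ⟨f, Fn, hS, hsm, hfl, hthr.trans hdec, hreg, hfac, hne⟩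
  obtain ⟨y, hy, hyψ⟩ := Submodule.mem_map.1 hψ
  obtain ⟨Φ₀, rfl⟩ := LinearMap.mem_range.1 hy
  exact ⟨Φ₀, f', Fn', hS', hsm', hfl', hthr'.trans hyψ.symm, hreg', hfac', hne'⟩

end Summit.HodgeConjecture.HodgeConjecture.Cruxes.HLiu418.K2LiuA7ValueWitnessOfSpanning

end
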